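import Summits.QuantumFields.YangMills.Theses.UnitScaleTilt
import Summits.QuantumFields.YangMills.Theorems.EntropyFloorHistoryTailOfGeometric
import Summits.QuantumFields.YangMills.Theorems.UnitScaleTiltHistoryTailOfPinnedHeightTail
import Summits.QuantumFields.YangMills.Theorems.EntropyFloorSuperpolyDoor

/-!
# Crux `HistoryTailL` (stmt-QuantumFields-19936) — PLAN «pinned (41)»: THE DEEP-HEIGHTS TARGET OF RECORD `stub_pinnedRatio` (v1.2, UNREGISTERED workfile)

Cell `ym3-torus`, rung R3 = continuum `SU(2)` Yang–Mills on the three-torus (NOT d = 4, NOT infinite volume, NOT a mass gap, NOT the Clay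
problem).  Ideator seat `ym-r3-idea-2` g16; mechanism and scope observation by `ym3-torus-px8` g10
(`pub/ym3-torus/ym3-torus-px8/g10/MECHANISM-PINNED41-px8g10.md`).

WHAT THIS FILE IS.  The line «entropy-floor» (`Lines/entropy_floor.lean`, this seat g4) reduces the crux to ONE floor stub
`EntropyFloor.stub_geometricTail` — a per-plaquette large-field tail `D·ρ^(K−j)` with `ρ·L³ < 1` whose constants `D, ρ` are chosen AFTER the
family `F` (hence after the volume `|T₁| = (2L^m)³`) and after the coupling `γ`; its bookkeeping half is PROVED
(`Theorems.EntropyFloorHistoryTailOfGeometric.historyTailL_of_geometricTail`).  px8 g10 observed (SCOPE FACT «VOLUME») that every OTHER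
registered intermediate of the crux (23532, 23133, 23083, 24187) is volume-UNIFORM, i.e. stronger than the crux needs, and proposed the
Bałaban-native mechanism «pinned (41)»: the final-step renormalised density restricted to histories with a large plaquette at height `j`
carries the small factor `exp(−¼p(g_{K−j})² + O(log g_{K−j}⁻¹))` of [Balaban1985UV3] (70)–(71) times a VOLUME-EXTENSIVE constant
`exp(C(L,γ)|T₁|)` (upper bound (41) pinned, lower bound (47)/(5)), which the floor's quantifier order admits.
v1.1 (★★OWNER WORD 47 (ii): `stub_pinnedRatio` is the cell's deep-heights TARGET OF RECORD; the ideator names ONE registry letter once the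
LEAD's socket K-19 ✓p742302 `UnitScaleTiltHistoryTailOfPinnedHeightTail` is in the tree).  THE LETTER := K-19's hypothesis `hP` VERBATIM —
§1 `stub_pinnedRatio` (XL): profile floors, then for EVERY profile above them and every `m`, a threshold `γ₁ ≤ 1`, then for each family and
coupling SEPARATELY constants `(C, c, A)` (volume-extensive `C`, ANY `c > 0` — the antecedent chain's constant is `c₁∕8`, px13 g11 ✓p742243
`UV3PinnedLargeFieldResummation.largeField_pinned_of_resummation`, NOT print's `¼`, which is why v1's hard-coded `¼` is retired), rate
`C·β_{K−j}^A·exp(−c·p(g_{K−j})²)` for the event «plaquette `a` large at height `j` AND every finer height small» at the constrained heights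
`1 ≤ j`, `j + 2 ≤ K`, `j + ⌊(K−1)∕m⌋ ≤ K`.  §2 `historyTailL_of_pinned := historyTailL_of_pinnedHeightTail stub_pinnedRatio` (K-19 BY NAME, one line,
sorry-free).  §3 keeps v1's two letters as SIBLING DOORS into the line «entropy-floor» (not on the cone of §2): `stub_pinnedRatioEF` (v1's
∃-profile, unconditioned, all-heights letter, now with `∃ c > 0`), `stub_superpolyDoor` (S–M real analysis, any `c > 0`; ★★OWNER WORD 47 (iv):
free to take by name), `geometricTail_of_pinnedEF` (sorry-free ⇒ ⟨EntropyFloor.stub_geometricTail⟩ verbatim) and `historyTailL_of_pinnedEF`.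
Its Z-level second layer (S-step: the pinned form of the STEP bound (41) for the indicator-weighted tower; S-dict; S-low (47) by name) lives over
the `Balaban3D` ∕ `B10.TowerRun` carriers and is typed by that lane (px13 g11, px8 g10), NOT here.  UNREGISTERED until ★★OWNER WORD 47 (iii)'s
triggers (α) antecedent skeleton typed, (β) idea-crit-5 passes the letter; the 19936 skeleton of record stays `sandwich_discharge` meanwhile.
Sorries ONLY in the two XL `stub_*` (`stub_pinnedRatio`, `stub_pinnedRatioEF`) since v1.2.
v1.2 (20:52Z): (a) §3 `stub_superpolyDoor` is ✓p743490 `EntropyFloorSuperpolyDoor.stub_superpolyDoor` BY NAME (px8 g10, ★★OWNER WORD 48∕49; sorries 3 → 2);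
(b) ★★OWNER WORD 47 (iii)(α′) is TYPED: the Z-level antecedent skeleton `Lines/pinned_stability.lean` @0cd261650895 (S-step = pinned (41) at the unit lattice on
the Literature's restricted tower `resDensity`, S-low = Thm 1 ratio form; sorry-free door `pinnedHeightTail_of : S-step → S-low → ⟨stub_pinnedRatio⟩`; crux by
name) — UNREGISTERED pending idea-crit-5 (β) on the two stub texts; (c) LEAD K-20 ✓p743503 `UnitScaleTiltHistoryTailOfWeakHeightTail` adds the weakest letter
`hW` with DOOR 1 (⟨`EntropyFloor.stub_geometricTail`⟩ → hW) and DOOR 2 (⟨K-19 hG⟩ → hW): §3's sibling chain lands through DOOR 1 as well; the letter of record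
stays K-19's `hP` (★★OWNER RECORD 17an), which §1 carries verbatim.

WHAT THIS IS NOT.  Nothing of `HistoryTailL`, of `stub_geometricTail`, of R3 is proved; `stub_pinnedRatio` is Bałaban's (71) summed into
a Gibbs-probability statement, which is NOT printed ([Balaban1985UV3] prints the Z-level factors only).

References: T. Bałaban, CMP **102** (1985) 255–275 [Balaban1985UV3] ((5) p.256, (7) p.257, (41) p.266, (47) p.267, (70)–(71) p.273).
-/

namespace Summit.QuantumFields.YangMills.Cruxes.HistoryTailL.EntropyFloor.PlanPinned41

open scoped BigOperators Topology Classical MeasureTheory ProbabilityTheory Matrix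
open Filter Set Function TopologicalSpace MeasureTheory

/-! ## §1 THE TARGET OF RECORD (★★OWNER WORD 47 (ii)): the registry letter = K-19's `hP` VERBATIM (the ONLY stub on the cone of §2) -/

/-- STUB P = **THE DEEP-HEIGHTS TARGET OF RECORD** (XL — px8 g10's mechanism «pinned (41)» in PROBABILITY currency, letter = LEAD ★w1 g11's
socket hypothesis `hP` of ✓p742302 VERBATIM): for every `L`, profile floors `(b₁', p₁')`; for every profile above them (`0 < b₀`, `2 < p₀`) and
every `m > 0` a threshold `γ₁ ∈ (0, 1]`; for EACH family `F` (`F.L = L`) and EACH `0 < γ ≤ γ₁` SEPARATELY constants `C ≥ 0`, `c > 0`, `A`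
(volume-extensive `C`; `c = c₁∕8` is what ✓`UV3PinnedLargeFieldResummation.largeField_pinned_of_resummation` delivers) with
`Gibbs_K({θ(K−j) ≤ |Ū^j(∂a) − 1|} ∩ {∀ i < j, every height-i plaquette small}) ≤ C·β_{K−j}^A·exp(−c·p(g_{K−j})²)` at the constrained heights.
Second layer (NOT typed here; `Balaban3D` ∕ `B10.TowerRun` carriers, px13 g11 ∕ px8 g10): S-step (pinned STEP bound (41) for the
indicator-weighted tower), S-dict (event ⇒ print's large-field condition at a pinned candidate, [Balaban1985Averaging]), S-low ((47)∕(5) by name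
modulo `AnalyticLeaves`). [cite: Balaban1985UV3, (41) p.266, (47) p.267, (70)-(71) p.273] -/
theorem stub_pinnedRatio :
    open Literature.MathematicalPhysics.QuantumFieldTheory.Balaban1983to89 Literature.MathematicalPhysics.QuantumFieldTheory.Balaban1983to89.T3ContinuumYM3Torus
      Literature.MathematicalPhysics.QuantumFieldTheory.Balaban1983to89.T3UnitScaleTilt Literature.MathematicalPhysics.QuantumFieldTheory.Balaban1983to89.T3UnitLawDensityEML in
    ∀ (L : ℕ), ∃ (b₁' p₁' : ℝ), ∀ (b₀ p₀ : ℝ), b₁' ≤ b₀ → p₁' ≤ p₀ → 0 < b₀ → 2 < p₀ → ∀ (m : ℕ), 0 < m →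
      ∃ γ₁ : ℝ, 0 < γ₁ ∧ γ₁ ≤ 1 ∧ ∀ (F : T3Family) (γ : ℝ), F.L = L → 0 < γ → γ ≤ γ₁ →
        ∃ (C c : ℝ) (A : ℕ), 0 ≤ C ∧ 0 < c ∧ ∀ (K j : ℕ), 1 ≤ j → j + 2 ≤ K → j + (K - 1) / m ≤ K → ∀ a : Plaq (F.P K) j,
          (gibbsK F ℰp γ K).real
              ({U : GaugeField (F.P K) 0 (Matrix.specialUnitaryGroup (Fin 2) ℂ) |
                  θBal F.L γ b₀ p₀ (K - j) ≤ GaugeGroup.dist1 (GaugeField.plaqHol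
                    (Averaging.iter (fun i' => BlockAveraging.blockAvg (P := F.P K) (j := i') ℰp) j U) a)} ∩
                {U : GaugeField (F.P K) 0 (Matrix.specialUnitaryGroup (Fin 2) ℂ) | ∀ i, i < j →
                  PlaqSmall (θBal F.L γ b₀ p₀ (K - i))
                    (Averaging.iter (fun i' => BlockAveraging.blockAvg (P := F.P K) (j := i') ℰp) i U)}) ≤
            C * (F.scheme ℰp γ).β (K - j) ^ A *
              Real.exp (-(c * B10.pFun b₀ p₀ (Real.sqrt (γ * ((F.L : ℝ)⁻¹) ^ (K - j))) ^ 2)) := by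
  sorry

/-! ## §2 The crux BY NAME from the target of record — K-19 ✓p742302 by name, no sorry -/

/-- **`UnitScaleTilt.HistoryTailL` FROM THE TARGET OF RECORD** by the LEAD's minimal socket
`UnitScaleTiltHistoryTailOfPinnedHeightTail.historyTailL_of_pinnedHeightTail`.  CONDITIONAL on `stub_pinnedRatio`; nothing of the crux is proved. -/
theorem historyTailL_of_pinned : Summit.QuantumFields.YangMills.Theses.UnitScaleTilt.HistoryTailL :=
  Summit.QuantumFields.YangMills.Theorems.UnitScaleTiltHistoryTailOfPinnedHeightTail.historyTailL_of_pinnedHeightTail stub_pinnedRatio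

/-! ## §3 SIBLING DOORS into the line «entropy-floor» (v1's letters; NOT on the cone of §2) -/

/-- STUB P-EF (XL, sibling letter — v1's `stub_pinnedRatio` with the constant freed: `∃ c > 0` in place of print's `¼`): under the floor stub's
∃-profile prefix, unconditioned, ALL heights `1 ≤ j ≤ K`, rate `Cv·g_{K−j}^(−N)·exp(−c·p(g_{K−j})²)`. [cite: Balaban1985UV3, (70)-(71) p.273] -/
theorem stub_pinnedRatioEF :
    open Literature.MathematicalPhysics.QuantumFieldTheory.Balaban1983to89 Literature.MathematicalPhysics.QuantumFieldTheory.Balaban1983to89.T3ContinuumYM3Torus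
      Literature.MathematicalPhysics.QuantumFieldTheory.Balaban1983to89.T3UnitScaleTilt Literature.MathematicalPhysics.QuantumFieldTheory.Balaban1983to89.T3UnitLawDensityEML in
    ∀ (L : ℕ) (b₁ p₁ : ℝ), ∃ (b₀ p₀ : ℝ), b₁ ≤ b₀ ∧ p₁ ≤ p₀ ∧ 0 < b₀ ∧ 2 < p₀ ∧ ∃ γ₁ : ℝ, 0 < γ₁ ∧ γ₁ ≤ 1 ∧
      ∀ (F : T3Family) (γ : ℝ), F.L = L → 0 < γ → γ ≤ γ₁ → ∃ (Cv c : ℝ) (N : ℕ), 0 ≤ Cv ∧ 0 < c ∧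
        ∀ (K j : ℕ), 1 ≤ j → j ≤ K → ∀ (p : Plaq (F.P K) j),
          (gibbsK F ℰp γ K).real {U | θBal F.L γ b₀ p₀ (K - j) ≤
              GaugeGroup.dist1 (GaugeField.plaqHol (Averaging.iter (fun i => BlockAveraging.blockAvg (P := F.P K) (j := i) ℰp) j U) p)}
            ≤ Cv * ((Real.sqrt (γ * ((L : ℝ)⁻¹) ^ (K - j)))⁻¹ ^ N *
                Real.exp (-(c * B10.pFun b₀ p₀ (Real.sqrt (γ * ((L : ℝ)⁻¹) ^ (K - j))) ^ 2))) := by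
  sorry

/-- STUB D — **PROVED ✓p743490** `EntropyFloorSuperpolyDoor.stub_superpolyDoor` (px8 g10; consumed BY NAME below, no sorry). Was: (S–M, real analysis; ★★OWNER WORD 47 (iv): free to take by name): for `1 < L`, `0 < γ ≤ 1`, `0 < b₀`, `2 < p₀`, any
`c > 0` and `N`: `∃ A ≥ 0, ∀ s, g_s^(−N)·exp(−c·p(g_s)²) ≤ A·(L⁻⁴)^s`, `g_s = √(γL^(−s))`, `p(g) = b₀(1 + log g⁻¹)^(p₀)` — the exponent
`(1 + ½(s·log L + log γ⁻¹))^(2p₀)`, `2p₀ > 4 > 1`, beats every multiple of `s·log L`. [cite: Balaban1985UV3, (7) p.257 and (71) p.273] -/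
theorem stub_superpolyDoor :
    open Literature.MathematicalPhysics.QuantumFieldTheory.Balaban1983to89 in
    ∀ (L : ℕ), 1 < L → ∀ (γ b₀ p₀ c : ℝ), 0 < γ → γ ≤ 1 → 0 < b₀ → 2 < p₀ → 0 < c → ∀ N : ℕ, ∃ A : ℝ, 0 ≤ A ∧
      ∀ s : ℕ, (Real.sqrt (γ * ((L : ℝ)⁻¹) ^ s))⁻¹ ^ N * Real.exp (-(c * B10.pFun b₀ p₀ (Real.sqrt (γ * ((L : ℝ)⁻¹) ^ s)) ^ 2))
        ≤ A * (((L : ℝ) ^ 4)⁻¹) ^ s :=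
  -- ✓p743490 (ym3-torus-px8 g10, ★★OWNER WORD 48/49): the v1.1 text VERBATIM, explicit `A = exp((N+8)²∕(4c·b₀²))`
  Summit.QuantumFields.YangMills.Theorems.EntropyFloorSuperpolyDoor.stub_superpolyDoor

/-- **THE «entropy-floor» FLOOR FROM THE SIBLING LETTER**: `stub_pinnedRatioEF → stub_superpolyDoor → ⟨EntropyFloor.stub_geometricTail⟩` (verbatim
statement) with `ρ := L⁻⁴` (`ρ·L³ = L⁻¹ < 1`) and `D := Cv·A`. [cite: Balaban1985UV3, (71) p.273] -/
theorem geometricTail_of_pinnedEF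
    (hP : open Literature.MathematicalPhysics.QuantumFieldTheory.Balaban1983to89
        Literature.MathematicalPhysics.QuantumFieldTheory.Balaban1983to89.T3ContinuumYM3Torus
        Literature.MathematicalPhysics.QuantumFieldTheory.Balaban1983to89.T3UnitScaleTilt
        Literature.MathematicalPhysics.QuantumFieldTheory.Balaban1983to89.T3UnitLawDensityEML in
      ∀ (L : ℕ) (b₁ p₁ : ℝ), ∃ (b₀ p₀ : ℝ), b₁ ≤ b₀ ∧ p₁ ≤ p₀ ∧ 0 < b₀ ∧ 2 < p₀ ∧ ∃ γ₁ : ℝ, 0 < γ₁ ∧ γ₁ ≤ 1 ∧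
      ∀ (F : T3Family) (γ : ℝ), F.L = L → 0 < γ → γ ≤ γ₁ → ∃ (Cv c : ℝ) (N : ℕ), 0 ≤ Cv ∧ 0 < c ∧
        ∀ (K j : ℕ), 1 ≤ j → j ≤ K → ∀ (p : Plaq (F.P K) j),
          (gibbsK F ℰp γ K).real {U | θBal F.L γ b₀ p₀ (K - j) ≤
              GaugeGroup.dist1 (GaugeField.plaqHol (Averaging.iter (fun i => BlockAveraging.blockAvg (P := F.P K) (j := i) ℰp) j U) p)}
            ≤ Cv * ((Real.sqrt (γ * ((L : ℝ)⁻¹) ^ (K - j)))⁻¹ ^ N *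
                Real.exp (-(c * B10.pFun b₀ p₀ (Real.sqrt (γ * ((L : ℝ)⁻¹) ^ (K - j))) ^ 2))))
    (hD : open Literature.MathematicalPhysics.QuantumFieldTheory.Balaban1983to89 in
      ∀ (L : ℕ), 1 < L → ∀ (γ b₀ p₀ c : ℝ), 0 < γ → γ ≤ 1 → 0 < b₀ → 2 < p₀ → 0 < c → ∀ N : ℕ, ∃ A : ℝ, 0 ≤ A ∧
      ∀ s : ℕ, (Real.sqrt (γ * ((L : ℝ)⁻¹) ^ s))⁻¹ ^ N * Real.exp (-(c * B10.pFun b₀ p₀ (Real.sqrt (γ * ((L : ℝ)⁻¹) ^ s)) ^ 2))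
        ≤ A * (((L : ℝ) ^ 4)⁻¹) ^ s) :
    open Literature.MathematicalPhysics.QuantumFieldTheory.Balaban1983to89 Literature.MathematicalPhysics.QuantumFieldTheory.Balaban1983to89.T3ContinuumYM3Torus
      Literature.MathematicalPhysics.QuantumFieldTheory.Balaban1983to89.T3UnitScaleTilt Literature.MathematicalPhysics.QuantumFieldTheory.Balaban1983to89.T3UnitLawDensityEML in
    ∀ (L : ℕ) (b₁ p₁ : ℝ), ∃ (b₀ p₀ : ℝ), b₁ ≤ b₀ ∧ p₁ ≤ p₀ ∧ 0 < b₀ ∧ 2 < p₀ ∧ ∃ γ₁ : ℝ, 0 < γ₁ ∧ γ₁ ≤ 1 ∧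
      ∀ (F : T3Family) (γ : ℝ), F.L = L → 0 < γ → γ ≤ γ₁ → ∃ (D ρ : ℝ), 0 ≤ D ∧ 0 ≤ ρ ∧ ρ * (L : ℝ) ^ 3 < 1 ∧
        ∀ (K j : ℕ), 1 ≤ j → j ≤ K → ∀ (p : Plaq (F.P K) j),
          (gibbsK F ℰp γ K).real {U | θBal F.L γ b₀ p₀ (K - j) ≤
              GaugeGroup.dist1 (GaugeField.plaqHol (Averaging.iter (fun i => BlockAveraging.blockAvg (P := F.P K) (j := i) ℰp) j U) p)}
            ≤ D * ρ ^ (K - j) := by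
  intro L b₁ p₁
  obtain ⟨b₀, p₀, hb, hp, hb₀, hp₀, γ₁, hγ₁, hγ₁1, hfam⟩ := hP L b₁ p₁
  refine ⟨b₀, p₀, hb, hp, hb₀, hp₀, γ₁, hγ₁, hγ₁1, fun F γ hFL hγ hγle => ?_⟩
  obtain ⟨Cv, c, N, hCv, hc, hbound⟩ := hfam F γ hFL hγ hγle
  have hL1 : 1 < L := hFL ▸ F.hL.2
  have hLr : (1 : ℝ) < (L : ℝ) := by exact_mod_cast hL1
  have hL0 : (0 : ℝ) < (L : ℝ) := by linarith
  obtain ⟨A, hA, hdoor⟩ := hD L hL1 γ b₀ p₀ c hγ (hγle.trans hγ₁1) hb₀ hp₀ hc N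
  refine ⟨Cv * A, ((L : ℝ) ^ 4)⁻¹, mul_nonneg hCv hA, by positivity, ?_, fun K j hj1 hjK p => ?_⟩
  · -- `L⁻⁴ · L³ = L⁻¹ < 1`
    have h4 : (0 : ℝ) < (L : ℝ) ^ 4 := by positivity
    rw [inv_mul_lt_iff₀ h4, mul_one]
    exact pow_lt_pow_right₀ hLr (by norm_num)
  · calc (Literature.MathematicalPhysics.QuantumFieldTheory.Balaban1983to89.T3UnitScaleTilt.gibbsK F
            Literature.MathematicalPhysics.QuantumFieldTheory.Balaban1983to89.T3UnitLawDensityEML.ℰp γ K).real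
            {U | Literature.MathematicalPhysics.QuantumFieldTheory.Balaban1983to89.T3UnitScaleTilt.θBal F.L γ b₀ p₀ (K - j) ≤
              Literature.MathematicalPhysics.QuantumFieldTheory.Balaban1983to89.GaugeGroup.dist1
                (Literature.MathematicalPhysics.QuantumFieldTheory.Balaban1983to89.GaugeField.plaqHol
                  (Literature.MathematicalPhysics.QuantumFieldTheory.Balaban1983to89.Averaging.iter
                    (fun i => Literature.MathematicalPhysics.QuantumFieldTheory.Balaban1983to89.BlockAveraging.blockAvg
                      (P := F.P K) (j := i) Literature.MathematicalPhysics.QuantumFieldTheory.Balaban1983to89.T3UnitLawDensityEML.ℰp) j U) p)}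
          ≤ Cv * ((Real.sqrt (γ * ((L : ℝ)⁻¹) ^ (K - j)))⁻¹ ^ N *
              Real.exp (-(c * Literature.MathematicalPhysics.QuantumFieldTheory.Balaban1983to89.B10.pFun b₀ p₀
                (Real.sqrt (γ * ((L : ℝ)⁻¹) ^ (K - j))) ^ 2))) := hbound K j hj1 hjK p
      _ ≤ Cv * (A * (((L : ℝ) ^ 4)⁻¹) ^ (K - j)) := mul_le_mul_of_nonneg_left (hdoor (K - j)) hCv
      _ = Cv * A * (((L : ℝ) ^ 4)⁻¹) ^ (K - j) := by ring

/-- **THE CRUX BY NAME THROUGH «entropy-floor»** from the sibling letters' STATEMENTS (landed door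
`EntropyFloorHistoryTailOfGeometric.historyTailL_of_geometricTail`).  CONDITIONAL on the two sibling stubs; nothing of the crux is proved. -/
theorem historyTailL_of_pinnedEF : Summit.QuantumFields.YangMills.Theses.UnitScaleTilt.HistoryTailL :=
  Summit.QuantumFields.YangMills.Theorems.EntropyFloorHistoryTailOfGeometric.historyTailL_of_geometricTail
    (geometricTail_of_pinnedEF stub_pinnedRatioEF stub_superpolyDoor)

end Summit.QuantumFields.YangMills.Cruxes.HistoryTailL.EntropyFloor.PlanPinned41
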